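import Literature.MathematicalPhysics.QuantumFieldTheory.Balaban1983to89.T4StabilitySocket
import Literature.MathematicalPhysics.QuantumFieldTheory.Balaban1983to89.Node00.Record13SepCoPHV

/-!
# BalabanUVNodes ∕ N13 — THE NORMALISATION CONTENT OF (B)'s COR-3 CONJUNCT, INTEGRATED (version-free): at ANY finite-ε datum `D`, [III] Cor. 3 (2.50) on a windowed run FORCES
# `e^{−e₋(g_K)|T₁^{(K)}|}·c_low(K) ≤ ∫ρ₀ dU ≤ e^{e₊(g_K)|T₁^{(K)}|}`; at the (revised) Stage-13 record `∫ρ₀ dU = e^{−E(P)}·Z_{T^{(0)}}(g₀⁻²)`, so the witness's constant `E(P) = EOfRecord₁₃ θ P`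
# must be the Wilson free energy `log Z` up to `O(|T₁^{(K)}|)` — at the record `|T₁^{(K)}| = (2L^m)⁴` is K-independent while `E(P)` and `log Z` are extensive in `|T₁^{(0)}| = (2L^{m+K})⁴`
# (Track A, DAG node N13 = [B16]; cluster K1 — K1⁸ `StabilityBRunRowsAtRecordR13SepCoPH` = stmt-QuantumFields-26907 (K1⁹ `…V` in plan g85's rev-28 kit), helper; seat `pub-ymgap-dag-n13-w3` g4;
# by name over `T4StabilitySocket` (cell `pub-balaban`) and DEF-1's p620607; 2026-08-28; count-neutral)

HONEST FRAMING.  Count-neutral kernel BOOKKEEPING (two integrations of the pin); nothing of Bałaban's is asserted or refuted.  This seat's p621736 ∕ p622818 priced N13's upper half by ONE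
inequality between MEASURES; its integrated face (`integral_rhoZero_le_of_towerMeasure_le`, p622818 §0) is the partition-function bound.  THIS FILE states the INTEGRATED content of the
pinned end statement itself — version-free by construction (integrals do not see `Classical.choose` versions), valid at the record datum, at every REVISED datum
`datumOfRecord₁₃SepCoPHV θ h v` (DEF-1 p620607: level 0 and all integrals are the record's), indeed at ANY `FiniteEpsData`:
* §1 (generic `D : FiniteEpsData F G`, regular gauge group) `integral_dens_top_le_of_cor3With` — `B16.Cor3With D.C γ em ep` + the run `⟨K, F.m, g₀⟩` in the γ-window ⟹ `∫ρ_K dV_K ≤ e^{e₊(g_K)·n_K}`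
  (`n_K` = the construction's `numSites K`); ★★ `normalisation_sandwich_of_cor3With` — with the sign convention `χ ≥ 0`: `e^{−e₋(g_K)·n_K} · smallFieldMass D K g₀ ≤ ∫ρ₀ dU_0 ≤ e^{e₊(g_K)·n_K}` —
  lower by `T4StabilitySocket.exp_neg_mul_smallFieldMass_le_integral_dens`, both through `(0.4)`'s mass conservation `FiniteEpsData.integral_dens_eq_zero` (`∫ρ_K = ∫ρ₀`).
* §2 (the revised Stage-13 record, any `N`, any slot `v`) `signConventions_datumOfRecord₁₃SepCoPHV` (`χ^{(2.9)} ∈ [0,1]`, K0e's `chiFix29OfRecord_mem_Icc`);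
  `integral_dens_zero_datumOfRecord₁₃SepCoPHV_eq` — `∫ρ₀ dU_0 = e^{−EOfRecord₁₃ θ ⟨K, F.m, g₀⟩} · partitionFn (F.P K) (g₀⁻²)` (the record's `ρ₀ = e^{−E}·e^{−A/g₀²}`, `densOfRecord₁₃_zero`);
  ★★★ `normalisationWindow_at_recordV_of_cor3With` — `B16.Cor3With (datumOfRecord₁₃SepCoPHV F N θ h v).C γ em ep` ⟹ on every windowed run
  `e^{−em(g_K)·n_K} · c_low(K) ≤ e^{−E(P)} · Z_K(g₀⁻²) ≤ e^{ep(g_K)·n_K}`; ★★★ `normalisationWindow_at_recordV_of_endStatementBPrinted` — the same from the K1⁹ (B)-slot letter's body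
  `B16.EndStatementBPrinted (datumⱽ v).C` with ITS `γ em ep`; log forms `log_partitionFn_sub_E_le_of_cor3With` (`log Z − E ≤ ep(g_K)·n_K`) and `…_ge_…` (`−em(g_K)·n_K + log c_low ≤ log Z − E`
  when `c_low > 0`).  At `v := Revision₁₃.refl θ h` these are statements about K1⁸'s own datum (`datumOfRecord₁₃SepCoPHV_refl`).
WHAT THIS SAYS (LOCATED, count-neutral, for the K0 ∕ K1 lanes and the planners): whatever density versions are chosen, (B)'s Cor-3 conjunct at a Stage-13 witness `θ` REQUIRES its normalisation
`EOfRecord₁₃ θ P = Σ_j eStepOfRecord θ P j` ([III] (1.15), Thm 1 p.262 «E is a normalization constant») to equal the Wilson free energy `log ∫ e^{−A/g₀²} dU` of the run's FINEST lattice within the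
window `[−ep(g_K)·n_K, em(g_K)·n_K − log c_low(K)]`, `n_K = |T₁^{(K)}|` (= `(2L^m)⁴` at the record, dag-n13-w3 g0 p588052 §5) — for EVERY γ-windowed run, hence for arbitrarily fine lattices at
bounded `e±(g_K)`.  The tree's K0-class witnesses read `Efl = logz = 0` (dag-n13-w1 p590719 ∕ `…LevelZeroAtRecord13SignFree`); whether their `Σ_j (log g_j·dim 𝔤 + log σ₀)·tstarCount_j` meets
this window is a NUMERICS question this file does not decide.  Nothing asserted or refuted; Cor. 3 NOT proved; N13 NOT discharged; K1⁸∕K1⁹ NEITHER proved NOR refuted; no stub closed; counts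
unmoved (typed 28∕28 · discharged 5∕27 · Track A 5∕28).  ONE finite four-torus programme at fixed `ε = L^{−K}`, Bałaban AS PRINTED; R4 closes the conditional finite-𝕋⁴ rung `BalabanLadder.UV`
only — the Yang–Mills mass gap (Clay) is NOT proved by any of this; nothing continuum ∕ ℝ⁴ ∕ OS.  No `sorry`, `def`, `instance`, `notation`.

Sources: [Balaban1988Convergent] (1.15) p.249, Thm 1 p.262, Cor. 3 (2.50) p.264; [Balaban1989LargeFieldII] Thm 1 + (0.1) pp.355–356; [Balaban1989LargeFieldI] (0.4) p.176 (mass conservation);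
[Balaban1985UV3] (6) p.257 (`∫ρ_K = c·Z`).
-/

noncomputable section

open MeasureTheory
open scoped BigOperators

namespace Summit.QuantumFields.YangMills.BalabanUVNodes.N13NormalisationWindowOfCor3AtRecord13SepCoPHV

open Literature.MathematicalPhysics.QuantumFieldTheory.Balaban1983to89
open T4Continuum Node00 Missing T4StabilitySocket

/-! ## §1. Generic: (2.50) on a windowed run, integrated at the top level, sandwiches `∫ρ₀ dU` -/

section Generic

variable {F : T4Family} {G : Type*} [GaugeGroup G] [MeasurableSpace G] [HaarData G] [RegularGaugeGroup G]

/-- **(2.50)-UPPER AT THE FINAL SCALE, INTEGRATED**: `Cor3With D.C γ em ep` and the run `⟨K, F.m, g₀⟩` in the γ-window ⟹ `∫ρ_K dV_K ≤ e^{e₊(g_K)·n_K}` (pointwise upper half integrated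
against the probability measure `dV_K`; `ρ_K` integrable by `integrable_dens_top`). [cite: Balaban1988Convergent, Cor. 3 (2.50) p.264 (bookkeeping)] -/
theorem integral_dens_top_le_of_cor3With (D : FiniteEpsData F G) {γ : ℝ} {em ep : ℝ → ℝ} (hcor : B16.Cor3With D.C γ em ep) (K : ℕ) (g₀ : ℝ)
    (hI : (D.C ⟨K, F.m, g₀⟩).flow.InInterval γ K) :
    ∫ V, D.dens K g₀ K V ∂fieldMeasure (F.P K) K G ≤ Real.exp (ep ((D.C ⟨K, F.m, g₀⟩).flow.g K) * ((D.C ⟨K, F.m, g₀⟩).numSites K : ℝ)) := by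
  have hpt : ∀ V : GaugeField (F.P K) K G, D.dens K g₀ K V ≤ Real.exp (ep ((D.C ⟨K, F.m, g₀⟩).flow.g K) * ((D.C ⟨K, F.m, g₀⟩).numSites K : ℝ)) :=
    fun V => (hcor ⟨K, F.m, g₀⟩ hI K le_rfl ((D.real.cfg K g₀ K).symm V)).2
  calc ∫ V, D.dens K g₀ K V ∂fieldMeasure (F.P K) K G
      ≤ ∫ _V, Real.exp (ep ((D.C ⟨K, F.m, g₀⟩).flow.g K) * ((D.C ⟨K, F.m, g₀⟩).numSites K : ℝ)) ∂fieldMeasure (F.P K) K G :=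
        integral_mono (integrable_dens_top D K g₀) (integrable_const _) hpt
    _ = Real.exp (ep ((D.C ⟨K, F.m, g₀⟩).flow.g K) * ((D.C ⟨K, F.m, g₀⟩).numSites K : ℝ)) := by
        rw [integral_const, smul_eq_mul, probReal_univ, one_mul]

/-- **★★ THE NORMALISATION SANDWICH.**  `Cor3With D.C γ em ep`, the sign convention `χ ≥ 0` and the run `⟨K, F.m, g₀⟩` in the γ-window ⟹
`e^{−e₋(g_K)·n_K} · c_low(K) ≤ ∫ρ₀ dU_0 ≤ e^{e₊(g_K)·n_K}` — both halves of (2.50) at `k = K` integrated, carried to the finest lattice by mass conservation `∫ρ_K dV_K = ∫ρ₀ dU_0`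
(`FiniteEpsData.integral_dens_eq_zero`).  VERSION-FREE: integrals only. [cite: Balaban1988Convergent, Cor. 3 (2.50) p.264; Balaban1989LargeFieldI, (0.4) p.176; Balaban1985UV3, (6) p.257 (bookkeeping)] -/
theorem normalisation_sandwich_of_cor3With (D : FiniteEpsData F G) (hsign : B16.SignConventions D.C) {γ : ℝ} {em ep : ℝ → ℝ} (hcor : B16.Cor3With D.C γ em ep)
    (K : ℕ) (g₀ : ℝ) (hI : (D.C ⟨K, F.m, g₀⟩).flow.InInterval γ K) :
    Real.exp (-(em ((D.C ⟨K, F.m, g₀⟩).flow.g K) * ((D.C ⟨K, F.m, g₀⟩).numSites K : ℝ))) * smallFieldMass D K g₀ ≤ ∫ U, D.dens K g₀ 0 U ∂fieldMeasure (F.P K) 0 G ∧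
      ∫ U, D.dens K g₀ 0 U ∂fieldMeasure (F.P K) 0 G ≤ Real.exp (ep ((D.C ⟨K, F.m, g₀⟩).flow.g K) * ((D.C ⟨K, F.m, g₀⟩).numSites K : ℝ)) := by
  rw [← D.integral_dens_eq_zero K g₀ K le_rfl]
  exact ⟨exp_neg_mul_smallFieldMass_le_integral_dens D hsign hcor K g₀ hI, integral_dens_top_le_of_cor3With D hcor K g₀ hI⟩

end Generic

/-! ## §2. At the (revised) Stage-13 record: `∫ρ₀ dU = e^{−E(P)}·Z_{T^{(0)}}(g₀⁻²)`, so (B) pins `E(P)` to the Wilson free energy within `O(|T₁^{(K)}|)` -/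

section Record

variable (F : T4Family) (N : ℕ) [NeZero N] (θ : Stage13HParams F N) (h : θ.Provisos₁₃SepCoPH F N) (v : Revision₁₃ F N θ h)

/-- The sign convention `χ_k ≥ 0` at every revised record datum (the slot keeps `χ = χ^{(2.9)}` of record; K0e's `chiFix29OfRecord_mem_Icc`). [cite: Balaban1987RG1, (2.9) p.266 (bookkeeping)] -/
theorem signConventions_datumOfRecord₁₃SepCoPHV : B16.SignConventions (datumOfRecord₁₃SepCoPHV F N θ h v).C :=
  fun P k V => (chiFix29OfRecord_mem_Icc θ.ν θ.ε₂₉ P.K k V).1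

/-- **`∫ρ₀ dU_0 = e^{−E(P)} · Z_{T^{(0)}}(g₀⁻²)` at every revised record datum**: the slot keeps level 0 (`dens_zero_datumOfRecord₁₃SepCoPHV`), the record's `ρ₀ = e^{−EOfRecord₁₃ θ P}·e^{−A/g₀²}`
(`densOfRecord₁₃_zero`, `rhoZeroOfRecord`), `Z = Missing.partitionFn`. [cite: Balaban1988Convergent, Thm 1 p.262, (1.15) p.249 (bookkeeping)] -/
theorem integral_dens_zero_datumOfRecord₁₃SepCoPHV_eq (K : ℕ) (g₀ : ℝ) :
    ∫ U, (datumOfRecord₁₃SepCoPHV F N θ h v).dens K g₀ 0 U ∂fieldMeasure (F.P K) 0 (SU N) =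
      Real.exp (-EOfRecord₁₃ F N θ.toStage13Params ⟨K, F.m, g₀⟩) * partitionFn (G := SU N) (F.P K) (g₀⁻¹ ^ 2) := by
  rw [dens_zero_datumOfRecord₁₃SepCoPHV, dens_datumOfRecord₁₃SepCoPH, densOfRecord₁₃_zero, partitionFn, ← integral_const_mul]
  rfl

/-- **★★★ (B)'s COR-3 CONJUNCT AT A REVISED RECORD DATUM PINS THE NORMALISATION `E(P)`.**  `B16.Cor3With (datumOfRecord₁₃SepCoPHV F N θ h v).C γ em ep` ⟹ for every run `⟨K, F.m, g₀⟩` in the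
γ-window: `e^{−em(g_K)·n_K} · c_low(K) ≤ e^{−EOfRecord₁₃ θ ⟨K, F.m, g₀⟩} · Z_{T^{(0)}}(g₀⁻²) ≤ e^{ep(g_K)·n_K}` with `n_K = |T₁^{(K)}|` the construction's site count and `c_low(K) = smallFieldMass`.
READING (LOCATED): `n_K = (2L^m)⁴` is K-independent at the record while `E` and `log Z` are extensive in `|T₁^{(0)}| = (2L^{m+K})⁴`; so any Stage-13 witness carrying (B) has its `EOfRecord₁₃`
equal to the Wilson free energy of the finest lattice up to a K-uniform `O((2L^m)⁴)` — a constraint on the numerics slots (`Efl`, `logz`, `σ₀`), version-free.  Nothing asserted or refuted.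
[cite: Balaban1988Convergent, (1.15) p.249, Thm 1 p.262, Cor. 3 (2.50) p.264; Balaban1989LargeFieldII, (0.1) pp.355–356] -/
theorem normalisationWindow_at_recordV_of_cor3With {γ : ℝ} {em ep : ℝ → ℝ} (hcor : B16.Cor3With (datumOfRecord₁₃SepCoPHV F N θ h v).C γ em ep)
    (K : ℕ) (g₀ : ℝ) (hI : ((datumOfRecord₁₃SepCoPHV F N θ h v).C ⟨K, F.m, g₀⟩).flow.InInterval γ K) :
    Real.exp (-(em (((datumOfRecord₁₃SepCoPHV F N θ h v).C ⟨K, F.m, g₀⟩).flow.g K) * (((datumOfRecord₁₃SepCoPHV F N θ h v).C ⟨K, F.m, g₀⟩).numSites K : ℝ))) *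
          smallFieldMass (datumOfRecord₁₃SepCoPHV F N θ h v) K g₀ ≤
        Real.exp (-EOfRecord₁₃ F N θ.toStage13Params ⟨K, F.m, g₀⟩) * partitionFn (G := SU N) (F.P K) (g₀⁻¹ ^ 2) ∧
      Real.exp (-EOfRecord₁₃ F N θ.toStage13Params ⟨K, F.m, g₀⟩) * partitionFn (G := SU N) (F.P K) (g₀⁻¹ ^ 2) ≤
        Real.exp (ep (((datumOfRecord₁₃SepCoPHV F N θ h v).C ⟨K, F.m, g₀⟩).flow.g K) * (((datumOfRecord₁₃SepCoPHV F N θ h v).C ⟨K, F.m, g₀⟩).numSites K : ℝ)) := by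
  rw [← integral_dens_zero_datumOfRecord₁₃SepCoPHV_eq F N θ h v K g₀]
  exact normalisation_sandwich_of_cor3With _ (signConventions_datumOfRecord₁₃SepCoPHV F N θ h v) hcor K g₀ hI

/-- **LOG FORM, UPPER**: `log Z_{T^{(0)}}(g₀⁻²) − E(P) ≤ ep(g_K)·n_K` on every windowed run (`Z > 0`, `Missing.partitionFn_pos'`). [cite: Balaban1988Convergent, Thm 1 p.262, Cor. 3 (2.50) p.264 (bookkeeping)] -/
theorem log_partitionFn_sub_E_le_of_cor3With {γ : ℝ} {em ep : ℝ → ℝ} (hcor : B16.Cor3With (datumOfRecord₁₃SepCoPHV F N θ h v).C γ em ep)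
    (K : ℕ) (g₀ : ℝ) (hI : ((datumOfRecord₁₃SepCoPHV F N θ h v).C ⟨K, F.m, g₀⟩).flow.InInterval γ K) :
    Real.log (partitionFn (G := SU N) (F.P K) (g₀⁻¹ ^ 2)) - EOfRecord₁₃ F N θ.toStage13Params ⟨K, F.m, g₀⟩ ≤
      ep (((datumOfRecord₁₃SepCoPHV F N θ h v).C ⟨K, F.m, g₀⟩).flow.g K) * (((datumOfRecord₁₃SepCoPHV F N θ h v).C ⟨K, F.m, g₀⟩).numSites K : ℝ) := by
  have hZ : 0 < partitionFn (G := SU N) (F.P K) (g₀⁻¹ ^ 2) := partitionFn_pos' (F.P K) (sq_nonneg _)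
  have h2 := (normalisationWindow_at_recordV_of_cor3With F N θ h v hcor K g₀ hI).2
  have h3 : Real.exp (Real.log (partitionFn (G := SU N) (F.P K) (g₀⁻¹ ^ 2)) - EOfRecord₁₃ F N θ.toStage13Params ⟨K, F.m, g₀⟩) ≤
      Real.exp (ep (((datumOfRecord₁₃SepCoPHV F N θ h v).C ⟨K, F.m, g₀⟩).flow.g K) * (((datumOfRecord₁₃SepCoPHV F N θ h v).C ⟨K, F.m, g₀⟩).numSites K : ℝ)) := by
    rw [Real.exp_sub, Real.exp_log hZ, div_eq_mul_inv, ← Real.exp_neg, mul_comm]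
    exact h2
  exact Real.exp_le_exp.1 h3

/-- **LOG FORM, LOWER**: when the small-field Wilson mass of the last step is positive, `−em(g_K)·n_K + log c_low(K) ≤ log Z_{T^{(0)}}(g₀⁻²) − E(P)`.
[cite: Balaban1988Convergent, Thm 1 p.262, Cor. 3 (2.50) p.264 (bookkeeping)] -/
theorem log_partitionFn_sub_E_ge_of_cor3With {γ : ℝ} {em ep : ℝ → ℝ} (hcor : B16.Cor3With (datumOfRecord₁₃SepCoPHV F N θ h v).C γ em ep)
    (K : ℕ) (g₀ : ℝ) (hI : ((datumOfRecord₁₃SepCoPHV F N θ h v).C ⟨K, F.m, g₀⟩).flow.InInterval γ K) (hpos : 0 < smallFieldMass (datumOfRecord₁₃SepCoPHV F N θ h v) K g₀) :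
    -(em (((datumOfRecord₁₃SepCoPHV F N θ h v).C ⟨K, F.m, g₀⟩).flow.g K) * (((datumOfRecord₁₃SepCoPHV F N θ h v).C ⟨K, F.m, g₀⟩).numSites K : ℝ)) +
        Real.log (smallFieldMass (datumOfRecord₁₃SepCoPHV F N θ h v) K g₀) ≤
      Real.log (partitionFn (G := SU N) (F.P K) (g₀⁻¹ ^ 2)) - EOfRecord₁₃ F N θ.toStage13Params ⟨K, F.m, g₀⟩ := by
  have hZ : 0 < partitionFn (G := SU N) (F.P K) (g₀⁻¹ ^ 2) := partitionFn_pos' (F.P K) (sq_nonneg _)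
  have h1 := (normalisationWindow_at_recordV_of_cor3With F N θ h v hcor K g₀ hI).1
  have hlhs : Real.exp (-(em (((datumOfRecord₁₃SepCoPHV F N θ h v).C ⟨K, F.m, g₀⟩).flow.g K) * (((datumOfRecord₁₃SepCoPHV F N θ h v).C ⟨K, F.m, g₀⟩).numSites K : ℝ)) +
        Real.log (smallFieldMass (datumOfRecord₁₃SepCoPHV F N θ h v) K g₀)) =
      Real.exp (-(em (((datumOfRecord₁₃SepCoPHV F N θ h v).C ⟨K, F.m, g₀⟩).flow.g K) * (((datumOfRecord₁₃SepCoPHV F N θ h v).C ⟨K, F.m, g₀⟩).numSites K : ℝ))) *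
        smallFieldMass (datumOfRecord₁₃SepCoPHV F N θ h v) K g₀ := by
    rw [Real.exp_add, Real.exp_log hpos]
  have hrhs : Real.exp (Real.log (partitionFn (G := SU N) (F.P K) (g₀⁻¹ ^ 2)) - EOfRecord₁₃ F N θ.toStage13Params ⟨K, F.m, g₀⟩) =
      Real.exp (-EOfRecord₁₃ F N θ.toStage13Params ⟨K, F.m, g₀⟩) * partitionFn (G := SU N) (F.P K) (g₀⁻¹ ^ 2) := by
    rw [Real.exp_sub, Real.exp_log hZ, div_eq_mul_inv, ← Real.exp_neg, mul_comm]
  exact Real.exp_le_exp.1 (by rw [hlhs, hrhs]; exact h1)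

/-- **★★★ THE K1⁹ (B)-SLOT LETTER's BODY PINS THE NORMALISATION**: `B16.EndStatementBPrinted (datumOfRecord₁₃SepCoPHV F N θ h v).C` ⟹ `∃ γ > 0, ∃ em ep`, on EVERY γ-windowed run
`⟨K, F.m, g₀⟩` the sandwich `e^{−em(g_K)·n_K}·c_low(K) ≤ e^{−E(P)}·Z_{T^{(0)}}(g₀⁻²) ≤ e^{ep(g_K)·n_K}`.  At `v := Revision₁₃.refl θ h` this is K1⁸'s own datum (`datumOfRecord₁₃SepCoPHV_refl`).
LOCATED reading as above; nothing asserted or refuted. [cite: Balaban1989LargeFieldII, Thm 1 + (0.1) pp.355–356; Balaban1988Convergent, Thm 1 p.262, Cor. 3 (2.50) p.264] -/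
theorem normalisationWindow_at_recordV_of_endStatementBPrinted (hB : B16.EndStatementBPrinted (datumOfRecord₁₃SepCoPHV F N θ h v).C) :
    ∃ γ : ℝ, 0 < γ ∧ ∃ em ep : ℝ → ℝ, ∀ (K : ℕ) (g₀ : ℝ), ((datumOfRecord₁₃SepCoPHV F N θ h v).C ⟨K, F.m, g₀⟩).flow.InInterval γ K →
      Real.exp (-(em (((datumOfRecord₁₃SepCoPHV F N θ h v).C ⟨K, F.m, g₀⟩).flow.g K) * (((datumOfRecord₁₃SepCoPHV F N θ h v).C ⟨K, F.m, g₀⟩).numSites K : ℝ))) *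
            smallFieldMass (datumOfRecord₁₃SepCoPHV F N θ h v) K g₀ ≤
          Real.exp (-EOfRecord₁₃ F N θ.toStage13Params ⟨K, F.m, g₀⟩) * partitionFn (G := SU N) (F.P K) (g₀⁻¹ ^ 2) ∧
        Real.exp (-EOfRecord₁₃ F N θ.toStage13Params ⟨K, F.m, g₀⟩) * partitionFn (G := SU N) (F.P K) (g₀⁻¹ ^ 2) ≤
          Real.exp (ep (((datumOfRecord₁₃SepCoPHV F N θ h v).C ⟨K, F.m, g₀⟩).flow.g K) * (((datumOfRecord₁₃SepCoPHV F N θ h v).C ⟨K, F.m, g₀⟩).numSites K : ℝ)) := by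
  obtain ⟨-, γ, hγ, em, ep, hcor⟩ := hB
  exact ⟨γ, hγ, em, ep, fun K g₀ hI => normalisationWindow_at_recordV_of_cor3With F N θ h v hcor K g₀ hI⟩

end Record

end Summit.QuantumFields.YangMills.BalabanUVNodes.N13NormalisationWindowOfCor3AtRecord13SepCoPHV

end
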